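import Mathlib

/-!
# `Balaban1983to89.B14Eq36LocRepr` — [Balaban1988Convergent] (2.16) p. 257, (3.6) p. 266, (3.17)–(3.18) p. 268:
the localized minimizers `U_{k,□}` and the representation identities «analogous to (3.6)» (SHAPE-LEVEL)

HONEST FRAMING (cell `lit-balaban`, verbatim): statement-level skeleton of published theorems with citation tags;
proofs where landed; nothing here is a claim about the Yang–Mills mass gap.

CITATION HEADER.  T. Bałaban, *Convergent renormalization expansions for lattice gauge theories*, Commun. Math.
Phys. **119** (1988) 243–285, doi:10.1007/bf01217741 [Balaban1988Convergent] (cell paper B14 = "[III]"; held text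
`paper:balaban1988-cmp119-convergent-renormalization`, journal page = PDF page + 242; (3.6) READ AS AN IMAGE from
`b2b-balaban-ref1/pages/1988-cmp119-convergent-renormalization/…-p024-x2.png` (p. 266), (3.17)–(3.18) from
`…-p026-x2.png` (p. 268), (2.16) from the held text p. 257 and — v1.1, referee finding N-g57-1 — RE-READ on the render
`pub-balaban/b2b-balaban-adv3/g22/renders/1988-cmp119-convergent-renormalization-p015-x2.png`: the datum of (2.16) is
`M˙(Q_k^{s*}V_k)`; v1 wrote the text layer's OCR slip «Q_k^{~4}» in the two (2.16) quotes below, now corrected — the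
superscript `~4` belongs to the enlarged cube `□^{~4}` only; no declaration changed; — v1.2, summit-lit1 STMTLOC row
Q31-003 (gen 31; reminder in CITELOC DELTA #21, gen 84): the page numeral of the [15] tag on `LocScheme` corrected, «Thm 1
p.300» → «Thm 1 p.279, (190) p.308» — [15] Theorem 1 is STATED on CMP **102** p. 279 [PDF 3] (held text
`paper:balaban1985-cmp102-variational-background` p0003 L8 «Theorem 1. There exist positive constants …») and (190) is
the last display of p. 308 [PDF 32] (render `b2b-balaban-ref1/pages/1985-cmp102-variational-background/…-p032-x2.png`
READ AS AN IMAGE: displays (185)–(190)); docstring-only, no declaration changed).  Unit `lit-balaban-r11` (reader/typer of B14),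
SKELETON rows `B14.Eq2.16`, `B14.Claim@265` (sub-display (3.6), cited downstream by B15 pp. 183–184 «(3.6) [III]»),
`B14.Eq3.16–3.19` (sub-displays (3.17), (3.18)).  [15] = T. Bałaban, CMP **102** (1985) 277–309
[Balaban1985Variational] (cell paper B11), Theorem 1 and (190); the CONCRETE determining-set vocabulary of [III] §2
(𝐁_k(Ω), M˙, U(𝐁, ·)) is r12's `B15DeterminingSets` (`DetSet`, `DetBackground`, `join214`) and `Setup.Averaging`;
this file is deliberately ABSTRACT (shape-level): it records the logical structure of the three identities, whose
analytic content is [15] Theorem 1 / (190), entered as the single named hypothesis `LocScheme.repr`.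

WHAT IS PRINTED.  (2.16) p. 257 [PDF 15]: *«U_{k,□}(V_k) = U(𝐁_k(□^{~4}), M˙(Q_k^{s*}V_k)),   (2.16)
where Q_k^{s*}V_k is defined as in (1.3), only 1-blocks are replaced by k-blocks»* (the field determined on the
determining set of the enlarged cube by the averages of the block-extended new field).  (3.6) p. 266 [PDF 24]:
*«For the function U_{k,□} we have
    U_{k,□} = U(𝐁_k(□^{~4}), [M˙(Q_k^{s*}V_k)(M˙(U_{k+1,□′}))⁻¹]M˙(U_{k+1,□′}))
           = (exp iη𝐇_{k,□}((1/i) log[M˙(Q_k^{s*}V_k)(M˙(U_{k+1,□′}))⁻¹]) U_{k+1,□′})^{u⁻¹_{k,□}}.   (3.6)»*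
(3.17) p. 268 [PDF 26]: *«This follows from the identity analogous to (3.6),
    U_{k+1} = U(𝐁_{k+1}(□′^{~4}), [M˙(U_{k+1})(M˙(Q^{s*}_{k+1}V_{k+1}))⁻¹]M˙(Q^{s*}_{k+1}V_{k+1}))
            = (exp iL⁻¹η𝐇_{k+1,□′}((1/i) log[M˙(U_{k+1})(M˙(Q^{s*}_{k+1}V_{k+1}))⁻¹]) U_{k+1,□′})^{u⁻¹_{k+1,□′}}.   (3.17)»*
and *«V^{(k)}(b) = u⁻¹_{k+1,□′}(b₋) exp iQ̄_k(L⁻¹η𝐇_{k+1,□′}) R̄^k u_{k+1,□′}(b₊) V^{(k)}_{□′}(b).   (3.18)»*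
(V^{(k)} = M^k(U_{k+1}), (3.4)/(3.10): V^{(k)}_{□′} = M^k(U_{k+1,□′})).

THE LOGICAL STRUCTURE, AS TYPED.  Determining data (finite families of group elements — the averages M˙(·)) form a
group `D` under pointwise multiplication; `Umin : D → F` is X ↦ U(𝐁, X) (the minimizer with data X); `Mdot : F → D`
is U ↦ M˙(U).  [15] Theorem 1 / (190) — the perturbative representation of the minimizer under a small multiplicative
perturbation `W` of the data — is the field `repr` of `LocScheme`:
`Umin (W·X) = ((exp iη𝐇_X((1/i) log W)) · Umin X)^{u⁻¹_{X,W}}` (abstract maps `logI`, `H`, `expMul`, `conj`, domain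
`Small`).  Then: (2.16) is `Uloc` (= `Umin` at the data M˙(Q^{s*}V)); the FIRST equalities of (3.6)/(3.17) are the group
identity `Y = (Y·X⁻¹)·X` on the data (`data_factor`); the SECOND equalities are `repr`; and the left members use
«the minimal configuration is reproduced from its own data», `Umin (Mdot U) = U` for the minimal U in question
(hypothesis `hrepro`, (2.12)–(2.13)).  `eq36`, `eq317` are these three-step rewritings; `eq318` is (3.18) from an
averaging-covariance hypothesis for M^k (how M^k acts on a gauge-transformed, exponentially perturbed field — [12]
= B7), nothing more.

WHAT IS PROVED (kernel-checked, no `sorry`, standard axioms): the rewritings `data_factor`, `eq36`, `eq36_data`,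
`eq317`, `eq318`.  Definitions: the structure `LocScheme` (a hypothesis bundle — its field `repr` IS [15] Thm 1/(190),
not proved here), `Uloc` ((2.16)).

WHAT IS NOT PROVED HERE (and not claimed): [15] Theorem 1 / (190) (row `B11.Thm1`, `B11.Eq190`); the bounds (3.7),
the (3.18)-bound on 𝐇_{k+1,□′} and (3.19) (rows `B14.Claim@265`, `B14.Eq3.16–3.19`: `B14Sect3.ineq37_*`,
`ineq319_scalar`); the reproduction property and the concrete 𝐁_k(□^{~4}), M˙ (r12's `B15DeterminingSets`) and
Q_k^{s*} ((1.3) with k-blocks: `BIJ85Sect2SurfaceAverages.BlockBonds.Qsstar`, `BIJ85Eq453GaugeField.qsstarG`).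
NOT summit progress: shape-level bookkeeping of three printed identities.
-/

namespace Literature.MathematicalPhysics.QuantumFieldTheory.Balaban1983to89.B14.Eq36LocRepr

/-! ## §1. The scheme: [15] Theorem 1 / (190) as a hypothesis bundle -/

/-- **The localized-minimizer scheme of [III] §§2–3.**  `D` = determining data (a group: pointwise products of the
averages `M˙(·)`), `F` = field configurations, `𝔥` = 𝔤-valued perturbation fields; `Umin X = U(𝐁, X)`,
`Mdot U = M˙(U)`, `logI W = (1/i) log W`, `H X A = 𝐇_X(A)` (the linear response operator built at the data X, scaled
by η resp. L⁻¹η), `expMul A U = (exp iA)·U`, `conj X W U = U^{u⁻¹_{X,W}}` (the gauge transformation of (3.6)/(3.17)),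
`Small W` = the domain |W − 1| small; `repr` = [15] Theorem 1 / the exponential-decay representation (190):
`U(𝐁, W·X) = ((exp i𝐇_X((1/i) log W)) U(𝐁, X))^{u⁻¹}` — A HYPOTHESIS, the analytic content of (3.6)/(3.17).
[cite: Balaban1988Convergent, (3.6) p.266, (3.17) p.268; Balaban1985Variational, Thm 1 p.279, (190) p.308] -/
structure LocScheme (D F 𝔥 : Type*) [Group D] where
  /-- `X ↦ U(𝐁, X)`: the minimal configuration with determining data `X`. -/
  Umin : D → F
  /-- `U ↦ M˙(U)`: the determining data (sequence of averages) of a configuration. -/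
  Mdot : F → D
  /-- `W ↦ (1/i) log W` (near `W = 1`). -/
  logI : D → 𝔥
  /-- `𝐇_X`: the response operator at the data `X` (including the factor η, resp. L⁻¹η). -/
  H : D → 𝔥 → 𝔥
  /-- `(A, U) ↦ (exp iA)·U`. -/
  expMul : 𝔥 → F → F
  /-- `U ↦ U^{u⁻¹_{X,W}}`: the gauge transformation of (3.6)/(3.17), determined by the data. -/
  conj : D → D → F → F
  /-- the smallness domain of the perturbation `W` (|W − 1| small, (3.7)/(3.19)). -/
  Small : D → Prop
  /-- **[15] Theorem 1 / (190)**: `U(𝐁, W·X) = ((exp i𝐇_X((1/i) log W))·U(𝐁, X))^{u⁻¹}` for small `W`. -/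
  repr : ∀ X W, Small W → Umin (W * X) = conj X W (expMul (H X (logI W)) (Umin X))

variable {D F 𝔥 : Type*} [Group D]

/-- **(2.16)** p. 257: `U_{k,□}(V_k) = U(𝐁_k(□^{~4}), M˙(Q_k^{s*}V_k))` («where Q_k^{s*}V_k is defined as in (1.3),
only 1-blocks are replaced by k-blocks») — the scheme's minimizer at the data `QV = M˙(Q_k^{s*}V_k)` of the
block-extended new field. [cite: Balaban1988Convergent, (2.16) p.257] -/
def Uloc (S : LocScheme D F 𝔥) (QV : D) : F := S.Umin QV

/-- The first equalities of (3.6)/(3.17) are the group identity on the data: `Y = (Y·X⁻¹)·X`.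
[cite: Balaban1988Convergent, (3.6) p.266, (3.17) p.268] -/
theorem data_factor (Y X : D) : Y = (Y * X⁻¹) * X := by
  rw [inv_mul_cancel_right]

/-! ## §2. (3.6), (3.17), (3.18) as rewritings -/

/-- **(3.6)** p. 266 [PDF 24]: with `QV = M˙(Q_k^{s*}V_k)`, `U′ = U_{k+1,□′}`, `X = M˙(U′)` and the perturbation
`W = M˙(Q_k^{s*}V_k)(M˙(U_{k+1,□′}))⁻¹` small: if `U′` is reproduced from its own k-level data
(`hrepro : U(𝐁_k(□^{~4}), M˙(U′)) = U′`), then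
`U_{k,□} = U(𝐁_k(□^{~4}), [W]M˙(U′)) = ((exp iη𝐇_{k,□}((1/i) log W)) U′)^{u⁻¹_{k,□}}`.
[cite: Balaban1988Convergent, (3.6) p.266] -/
theorem eq36 (S : LocScheme D F 𝔥) (QV : D) (U' : F) (hsmall : S.Small (QV * (S.Mdot U')⁻¹))
    (hrepro : S.Umin (S.Mdot U') = U') :
    Uloc S QV = S.conj (S.Mdot U') (QV * (S.Mdot U')⁻¹)
      (S.expMul (S.H (S.Mdot U') (S.logI (QV * (S.Mdot U')⁻¹))) U') := by
  unfold Uloc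
  conv_lhs => rw [data_factor QV (S.Mdot U')]
  rw [S.repr _ _ hsmall, hrepro]

/-- (3.6), first equality alone: `U_{k,□} = U(𝐁_k(□^{~4}), [M˙(Q^{s*}V_k)(M˙(U_{k+1,□′}))⁻¹]M˙(U_{k+1,□′}))`.
[cite: Balaban1988Convergent, (3.6) p.266] -/
theorem eq36_data (S : LocScheme D F 𝔥) (QV : D) (U' : F) :
    Uloc S QV = S.Umin ((QV * (S.Mdot U')⁻¹) * S.Mdot U') := by
  unfold Uloc
  rw [inv_mul_cancel_right]

/-- **(3.17)** p. 268 [PDF 26], «the identity analogous to (3.6)»: with `X = M˙(Q^{s*}_{k+1}V_{k+1})` (so that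
`U_{k+1,□′} = U(𝐁_{k+1}(□′^{~4}), X)`, (2.16)), the perturbation `W = M˙(U_{k+1})X⁻¹` small, and `U_{k+1}`
reproduced from its own data (`hrepro`):
`U_{k+1} = U(𝐁_{k+1}(□′^{~4}), [W]X) = ((exp iL⁻¹η𝐇_{k+1,□′}((1/i) log W)) U_{k+1,□′})^{u⁻¹_{k+1,□′}}`.
[cite: Balaban1988Convergent, (3.17) p.268] -/
theorem eq317 (S : LocScheme D F 𝔥) (X : D) (U : F) (hsmall : S.Small (S.Mdot U * X⁻¹))
    (hrepro : S.Umin (S.Mdot U) = U) :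
    U = S.conj X (S.Mdot U * X⁻¹) (S.expMul (S.H X (S.logI (S.Mdot U * X⁻¹))) (Uloc S X)) := by
  unfold Uloc
  conv_lhs => rw [← hrepro, data_factor (S.Mdot U) X]
  exact S.repr _ _ hsmall

/-- **(3.18)** p. 268 [PDF 26]: applying the averaging `M^k` to (3.17) — under the covariance of the averaging with
respect to gauge transformations and exponential perturbations ([12] = B7; hypothesis `hcov`: `M^k` of the
transformed field is the correspondingly "twisted" average, print's `u⁻¹(b₋) exp iQ̄_k(L⁻¹η𝐇) R̄^k u(b₊) ·`) one gets
`V^{(k)} = M^k(U_{k+1}) = twist(M^k(U_{k+1,□′})) = twist(V^{(k)}_{□′})`.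
[cite: Balaban1988Convergent, (3.18) p.268] -/
theorem eq318 {V : Type*} (S : LocScheme D F 𝔥) (Mk : F → V) (twist : D → D → 𝔥 → V → V)
    (hcov : ∀ X W A U, Mk (S.conj X W (S.expMul A U)) = twist X W A (Mk U))
    (X : D) (U : F) (hsmall : S.Small (S.Mdot U * X⁻¹)) (hrepro : S.Umin (S.Mdot U) = U) :
    Mk U = twist X (S.Mdot U * X⁻¹) (S.H X (S.logI (S.Mdot U * X⁻¹))) (Mk (Uloc S X)) := by
  conv_lhs => rw [eq317 S X U hsmall hrepro]
  exact hcov _ _ _ _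

end Literature.MathematicalPhysics.QuantumFieldTheory.Balaban1983to89.B14.Eq36LocRepr
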